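import Mathlib
import Summits.ValiantsHypothesis.ValiantsHypothesis.Theorems.NewtonUnitEquationsTwoProductsFormalLogLinearisationLiftedCellRank
import HarnessLib

/-!
# Route NewtonUnitEquations — crux `TwoProducts` (stmt-ValiantsHypothesis-5906), line `formal-log-linearisation`:
# the LIFTED PENCIL COUNT holds — `#visible ≤ 2(s²+1)(log₂ n + 1) n^{2 log₂ n}`, i.e. `≤ 2^{13m}(s+2)²`

Registered line `Cruxes/TwoProducts/Lines/formal-log-linearisation.lean` (NOT the item's skeleton of record; helper
mode `--supports stmt-ValiantsHypothesis-5906 --as helper`, no stub credit claimed).  Sixth file of the Hankel-rank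
tool; closes the THEORY-lane question of `memo-logSumEngine-core.md` (val-width-0318-p2, evidence #45 on the item):
the memo's `LiftedPencilCount` — recorded as text in `…LiftedNecessity.lean`, proved NECESSARY for the engine and for
the crux in `…LiftedNecessityReal.lean` (`liftedPencilCount_of_twoProducts`) — is TRUE unconditionally.

**Proof.**  (1) SWEEP: along a pencil `u + t·v` the weight order of the `s` coordinates is determined by the position
of `t` relative to the `≤ s²` crossing times, so the visible points split into `≤ 2(s² + 1)` CELL FAMILIES (common
weight order); `pencilOrder_classes_card_le`.  (2) CELL: a cell family has `≤ (log₂ n + 1)·n^{2 log₂ n}` members,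
`n` the number of exponential terms (`ExpSum.pencilCount_cell`, previous file: hyperbolic cross for the shapes, the
slot-rank lemma — Hankel rank `≤ n` of `F(α+β)` against coordinate replacement along the common order — for the
slots).  Hence

* `ExpSum.pencilCount` — for ANY finite signed sum of `n` monomial characters on `ℕ^s` and ANY real pencil `u + t v`,
  every finite set of pencil-visible points of `{F ≠ 0}` has `≤ 2(s²+1)(log₂ n + 1) n^{2 log₂ n}` elements;
* `liftedPencilCount_bound` — two `m`-point configurations: `≤ 2(s²+1)(log₂ 2m + 1)(2m)^{2 log₂ 2m}`;
* `liftedPencilCount` — **the memo's statement verbatim with `a = 13`, `b = 2`**: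
  `#S ≤ 2^{13m}(s+2)²` for every `m, s, A, B`, strictly positive `θ₁, θ₂`, and every finite set `S` of pencil-visible
  unequal moments.

What this does and does not say.  It settles the lifted/combinatorial shadow count that the engine NEEDS (so the
"refute the crux through `LiftedPencilCount`" route of the memo is closed, and the kit searches' linear-looking data are
explained up to the quasi-polynomial factor in `m`); it does NOT prove the engine `stub_logSumEngine` (fibre
cancellation between the lifted count and the planar log-support is the remaining content, memo §3), nor the crux
`TwoProducts`, which stay OPEN; the line is not the item's skeleton of record, and nothing here is progress on
`VP ≠ VNP` (NOT proved).  No definitions, no named facts. [folklore]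
-/

noncomputable section

-- Sub = Summit single-conjunct layout: the duplicated namespace component is mandated by the tree.
set_option linter.dupNamespace false

namespace Summit.ValiantsHypothesis.ValiantsHypothesis.Theorems.NewtonUnitEquations.TwoProducts.FormalLogLinearisation

open scoped BigOperators

variable {s : ℕ}

/-- An affine function with no root weakly between `t` and `t'` has the same sign at `t` and `t'`:
if `α + t β ≥ 0`-ness differed, the root `-α/β` would lie between them. [folklore] -/
theorem affine_sign_stable (α β t t' : ℝ)
    (hroot : β ≠ 0 → ¬ (min t t' ≤ -α / β ∧ -α / β ≤ max t t')) :
    (0 ≤ α + t * β ↔ 0 ≤ α + t' * β) := by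
  by_cases hβ : β = 0
  · simp [hβ]
  have h := hroot hβ
  rw [not_and_or, not_le, not_le] at h
  have key : ∀ x : ℝ, (0 ≤ α + x * β ↔ (0 < β ∧ -α / β ≤ x) ∨ (β < 0 ∧ x ≤ -α / β)) := by
    intro x
    rcases lt_or_gt_of_ne hβ with hneg | hpos
    · constructor
      · intro hx; right; refine ⟨hneg, ?_⟩
        rw [le_div_iff_of_neg hneg]; linarith
      · rintro (⟨hp, _⟩ | ⟨_, hx⟩); · linarith
        rw [le_div_iff_of_neg hneg] at hx; linarith
    · constructor
      · intro hx; left; refine ⟨hpos, ?_⟩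
        rw [div_le_iff₀ hpos]; linarith
      · rintro (⟨_, hx⟩ | ⟨hn, _⟩)
        · rw [div_le_iff₀ hpos] at hx; linarith
        · linarith
  rw [key t, key t']
  rcases h with h1 | h2
  · -- root below both
    have ht : -α / β < t := lt_of_lt_of_le h1 (min_le_left _ _)
    have ht' : -α / β < t' := lt_of_lt_of_le h1 (min_le_right _ _)
    constructor
    · rintro (⟨hp, _⟩ | ⟨_, hx⟩); · exact Or.inl ⟨hp, ht'.le⟩
      linarith
    · rintro (⟨hp, _⟩ | ⟨_, hx⟩); · exact Or.inl ⟨hp, ht.le⟩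
      linarith
  · have ht : t < -α / β := lt_of_le_of_lt (le_max_left _ _) h2
    have ht' : t' < -α / β := lt_of_le_of_lt (le_max_right _ _) h2
    constructor
    · rintro (⟨_, hx⟩ | ⟨hn, _⟩); · linarith
      exact Or.inr ⟨hn, ht'.le⟩
    · rintro (⟨_, hx⟩ | ⟨hn, _⟩); · linarith
      exact Or.inr ⟨hn, ht.le⟩

/-- **SWEEP: the weight orders along a pencil fall into `≤ 2(s²+1)` classes.**  For `u, v : Fin s → ℝ` there is a
"cell code" `code : ℝ → ℕ × Bool` taking at most `2(s² + 1)` values such that parameters with the same code induce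
the same weight order `j ↦ u_j + t v_j` on the coordinates (`code t` = (number of crossing times below `t`, whether `t`
is a crossing time)). [folklore] -/
theorem pencilOrder_classes (u v : Fin s → ℝ) :
    ∃ code : ℝ → ℕ × Bool, (∀ t, code t ∈ (Finset.range (s * s + 1)) ×ˢ (Finset.univ : Finset Bool)) ∧
      ∀ t t', code t = code t' →
        ∀ j j' : Fin s, (u j + t * v j ≤ u j' + t * v j') ↔ (u j + t' * v j ≤ u j' + t' * v j') := by
  classical
  -- crossing times
  let X : Finset ℝ := (Finset.univ : Finset (Fin s × Fin s)).image
    fun p => -(u p.2 - u p.1) / (v p.2 - v p.1)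
  have hXcard : X.card ≤ s * s := by
    refine Finset.card_image_le.trans ?_
    simp [Finset.card_univ]
  have hroot_mem : ∀ j j' : Fin s, -(u j' - u j) / (v j' - v j) ∈ X := fun j j' =>
    Finset.mem_image.2 ⟨(j, j'), Finset.mem_univ _, rfl⟩
  refine ⟨fun t => ((X.filter (· < t)).card, decide (t ∈ X)), fun t => ?_, fun t t' hcode j j' => ?_⟩
  · refine Finset.mem_product.2 ⟨Finset.mem_range.2 ?_, Finset.mem_univ _⟩
    exact Nat.lt_succ_of_le ((Finset.card_filter_le _ _).trans hXcard)
  · have hcnt : (X.filter (· < t)).card = (X.filter (· < t')).card := congrArg Prod.fst hcode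
    have hmem : (t ∈ X ↔ t' ∈ X) := by
      have := congrArg Prod.snd hcode
      simpa using this
    -- no crossing time lies weakly between `t` and `t'` unless `t = t'`
    have hbetween : ∀ x ∈ X, min t t' ≤ x → x ≤ max t t' → t = t' := by
      intro x hx h1 h2
      by_contra hne
      rcases lt_or_gt_of_ne hne with hlt | hlt
      · rw [min_eq_left hlt.le] at h1; rw [max_eq_right hlt.le] at h2
        -- `x ∈ [t, t')` or `x = t'`
        have hsub : X.filter (· < t) ⊆ X.filter (· < t') := by
          intro y hy
          simp only [Finset.mem_filter] at hy ⊢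
          exact ⟨hy.1, hy.2.trans hlt⟩
        rcases eq_or_lt_of_le h2 with rfl | h2'
        · -- `x = t'` is a crossing time, so is `t` (same code), and `t < t'` is counted below `t'` but not below `t`
          have ht : t ∈ X := hmem.2 hx
          have : t ∈ X.filter (· < x) := Finset.mem_filter.2 ⟨ht, hlt⟩
          have hne' : X.filter (· < t) ≠ X.filter (· < x) := by
            intro h; rw [h] at hsub
            have := Finset.mem_filter.1 (h ▸ this : t ∈ X.filter (· < t))
            exact lt_irrefl _ this.2
          exact hne' (Finset.eq_of_subset_of_card_le hsub hcnt.ge)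
        · have : x ∈ X.filter (· < t') := Finset.mem_filter.2 ⟨hx, h2'⟩
          have hnot : x ∉ X.filter (· < t) := fun h => not_lt.2 h1 (Finset.mem_filter.1 h).2
          have hne' : X.filter (· < t) ≠ X.filter (· < t') := fun h => hnot (h ▸ this)
          exact hne' (Finset.eq_of_subset_of_card_le hsub hcnt.ge)
      · rw [min_eq_right hlt.le] at h1; rw [max_eq_left hlt.le] at h2
        have hsub : X.filter (· < t') ⊆ X.filter (· < t) := by
          intro y hy
          simp only [Finset.mem_filter] at hy ⊢
          exact ⟨hy.1, hy.2.trans hlt⟩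
        rcases eq_or_lt_of_le h2 with rfl | h2'
        · have ht' : t' ∈ X := hmem.1 hx
          have : t' ∈ X.filter (· < x) := Finset.mem_filter.2 ⟨ht', hlt⟩
          have hne' : X.filter (· < t') ≠ X.filter (· < x) := by
            intro h; rw [h] at hsub
            have := Finset.mem_filter.1 (h ▸ this : t' ∈ X.filter (· < t'))
            exact lt_irrefl _ this.2
          exact hne' (Finset.eq_of_subset_of_card_le hsub hcnt.le)
        · have : x ∈ X.filter (· < t) := Finset.mem_filter.2 ⟨hx, h2'⟩
          have hnot : x ∉ X.filter (· < t') := fun h => not_lt.2 h1 (Finset.mem_filter.1 h).2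
          have hne' : X.filter (· < t') ≠ X.filter (· < t) := fun h => hnot (h ▸ this)
          exact hne' (Finset.eq_of_subset_of_card_le hsub hcnt.le)
    by_cases htt : t = t'
    · rw [htt]
    -- the affine function `(u j' - u j) + τ (v j' - v j)` has no root between `t` and `t'`
    have h := affine_sign_stable (u j' - u j) (v j' - v j) t t' fun _ hb =>
      htt (hbetween _ (hroot_mem j j') hb.1 hb.2)
    constructor
    · intro hle
      have : 0 ≤ (u j' - u j) + t * (v j' - v j) := by linarith
      have := h.1 this; linarith
    · intro hle
      have : 0 ≤ (u j' - u j) + t' * (v j' - v j) := by linarith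
      have := h.2 this; linarith

namespace ExpSum

/-- **LIFTED PENCIL COUNT, general signed exponential sum.**  For `F(ν) = Σ_{k ∈ κ} c_k ∏_i a_{ki}^{ν_i}` on `ℕ^s`
(`n = |κ|`) and any real pencil `u + t·v`, every finite set of points `μ` with `F(μ) ≠ 0`, each the STRICT
`(u + t v)`-minimiser of `{F ≠ 0}` for some real `t`, has at most `2(s² + 1)·(log₂ n + 1)·n^{2 log₂ n}` elements
(sweep over `≤ 2(s²+1)` cells × the per-cell bound `ExpSum.pencilCount_cell`). [folklore] -/
theorem pencilCount {κ : Type*} [Fintype κ] (c : κ → ℂ) (a : κ → Fin s → ℂ) (u v : Fin s → ℝ)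
    (S : Finset (Fin s → ℕ))
    (hS : ∀ μ ∈ S, (∑ k, c k * ∏ i, a k i ^ μ i) ≠ 0 ∧ ∃ t : ℝ,
      ∀ ν : Fin s → ℕ, ν ≠ μ → (∑ k, c k * ∏ i, a k i ^ ν i) ≠ 0 →
        ∑ i, (u i + t * v i) * (μ i : ℝ) < ∑ i, (u i + t * v i) * (ν i : ℝ)) :
    S.card ≤ 2 * (s * s + 1) *
      ((Nat.log 2 (Fintype.card κ) + 1) * Fintype.card κ ^ (2 * Nat.log 2 (Fintype.card κ))) := by
  classical
  obtain ⟨code, hcode_mem, hcode⟩ := pencilOrder_classes u v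
  -- choose the parameters
  have hS' : ∀ μ ∈ S, ∃ t : ℝ, ∀ ν : Fin s → ℕ, ν ≠ μ → (∑ k, c k * ∏ i, a k i ^ ν i) ≠ 0 →
      ∑ i, (u i + t * v i) * (μ i : ℝ) < ∑ i, (u i + t * v i) * (ν i : ℝ) := fun μ hμ => (hS μ hμ).2
  choose! τ hτ using hS'
  -- fibres of the cell code are cell families
  have hfib : ∀ k ∈ S.image (fun μ => code (τ μ)), (S.filter fun μ => code (τ μ) = k).card ≤
      (Nat.log 2 (Fintype.card κ) + 1) * Fintype.card κ ^ (2 * Nat.log 2 (Fintype.card κ)) := by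
    intro k hk
    obtain ⟨μ₀, hμ₀, rfl⟩ := Finset.mem_image.1 hk
    refine pencilCount_cell c a u v (fun j j' => u j + τ μ₀ * v j ≤ u j' + τ μ₀ * v j') _ fun μ hμ => ?_
    obtain ⟨hμS, hμk⟩ := Finset.mem_filter.1 hμ
    exact ⟨(hS μ hμS).1, τ μ, hτ μ hμS, fun j j' => hcode _ _ hμk.symm j j'⟩
  have himg : (S.image fun μ => code (τ μ)).card ≤ 2 * (s * s + 1) := by
    calc (S.image fun μ => code (τ μ)).card
        ≤ ((Finset.range (s * s + 1)) ×ˢ (Finset.univ : Finset Bool)).card :=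
          Finset.card_le_card fun k hk => by
            obtain ⟨μ, _, rfl⟩ := Finset.mem_image.1 hk
            exact hcode_mem _
      _ = 2 * (s * s + 1) := by simp [Finset.card_product, mul_comm]
  calc S.card ≤ (Nat.log 2 (Fintype.card κ) + 1) * Fintype.card κ ^ (2 * Nat.log 2 (Fintype.card κ)) *
        (S.image fun μ => code (τ μ)).card := Finset.card_le_mul_card_image S _ hfib
    _ ≤ (Nat.log 2 (Fintype.card κ) + 1) * Fintype.card κ ^ (2 * Nat.log 2 (Fintype.card κ)) *
        (2 * (s * s + 1)) := Nat.mul_le_mul_left _ himg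
    _ = _ := by ring

end ExpSum

/-- **Lifted pencil count for two configurations (explicit form).**  For `A, B : Fin m → Fin s → ℂ` and any real
pencil, every finite set of pencil-visible unequal moments has at most `2(s²+1)(log₂ 2m + 1)(2m)^{2 log₂ 2m}` elements.
[folklore] -/
theorem liftedPencilCount_bound {m s : ℕ} (A B : Fin m → Fin s → ℂ) (θ₁ θ₂ : Fin s → ℝ)
    (S : Finset (Fin s → ℕ))
    (hS : ∀ μ ∈ S, (∑ j, ∏ i, A j i ^ μ i) ≠ (∑ j, ∏ i, B j i ^ μ i) ∧
      ∃ c : ℝ, 0 < c ∧ ∀ ν : Fin s → ℕ, ν ≠ μ →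
        (∑ j, ∏ i, A j i ^ ν i) ≠ (∑ j, ∏ i, B j i ^ ν i) →
          ∑ i, (θ₁ i + c * θ₂ i) * (μ i : ℝ) < ∑ i, (θ₁ i + c * θ₂ i) * (ν i : ℝ)) :
    S.card ≤ 2 * (s * s + 1) * ((Nat.log 2 (2 * m) + 1) * (2 * m) ^ (2 * Nat.log 2 (2 * m))) := by
  have hcardκ : Fintype.card (Fin m ⊕ Fin m) = 2 * m := by simp [Fintype.card_sum, two_mul]
  rw [← hcardκ]
  refine ExpSum.pencilCount (Sum.elim (fun _ => (1 : ℂ)) (fun _ => -1)) (Sum.elim A B) θ₁ θ₂ S fun μ hμ => ?_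
  obtain ⟨hμ', c, -, hmin⟩ := hS μ hμ
  refine ⟨?_, c, fun ν hν hFν => hmin ν hν ?_⟩
  · rw [unequalMoment_eq_expSum]; exact sub_ne_zero.2 hμ'
  · rw [unequalMoment_eq_expSum] at hFν; exact sub_ne_zero.1 hFν

/-- Arithmetic: `ℓ² ≤ 2^(ℓ+1)`. [folklore] -/
theorem sq_le_two_pow_succ (ℓ : ℕ) : ℓ * ℓ ≤ 2 ^ (ℓ + 1) := by
  induction ℓ with
  | zero => simp
  | succ k ih =>
    have hk : k < 2 ^ k := Nat.lt_two_pow_self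
    have : (k + 1) * (k + 1) = k * k + (2 * k + 1) := by ring
    rw [this, pow_succ]
    omega

/-- Arithmetic: the explicit bound is at most `2^{13m}(s+2)²` (for `m ≥ 1`). [folklore] -/
theorem liftedPencilCount_arith (m s : ℕ) (hm : 1 ≤ m) :
    2 * (s * s + 1) * ((Nat.log 2 (2 * m) + 1) * (2 * m) ^ (2 * Nat.log 2 (2 * m))) ≤
      2 ^ (13 * m) * (s + 2) ^ 2 := by
  set ℓ := Nat.log 2 (2 * m) with hℓ
  -- `2^ℓ ≤ 2m < 2^(ℓ+1)`
  have h1 : 2 ^ ℓ ≤ 2 * m := Nat.pow_log_le_self 2 (by omega)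
  have h2 : 2 * m < 2 ^ (ℓ + 1) := Nat.lt_pow_succ_log_self (by norm_num) _
  have hm2 : m < 2 ^ m := Nat.lt_two_pow_self
  -- `ℓ ≤ m`
  have hℓm : ℓ ≤ m := by
    by_contra h
    push Not at h
    have : 2 ^ (m + 1) ≤ 2 ^ ℓ := Nat.pow_le_pow_right (by norm_num) h
    rw [pow_succ] at this
    omega
  -- `ℓ² ≤ 4m`
  have hℓsq : ℓ * ℓ ≤ 4 * m := by
    have := sq_le_two_pow_succ ℓ
    rw [pow_succ] at this
    omega
  -- `(2m)^(2ℓ) ≤ 2^(2ℓ(ℓ+1)) ≤ 2^(10 m)`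
  have h3 : (2 * m) ^ (2 * ℓ) ≤ 2 ^ (10 * m) := by
    calc (2 * m) ^ (2 * ℓ) ≤ (2 ^ (ℓ + 1)) ^ (2 * ℓ) := Nat.pow_le_pow_left h2.le _
      _ = 2 ^ ((ℓ + 1) * (2 * ℓ)) := by rw [← pow_mul]
      _ ≤ 2 ^ (10 * m) := Nat.pow_le_pow_right (by norm_num) (by nlinarith)
  -- `ℓ + 1 ≤ 2m ≤ 2^(m+1)`
  have h4 : ℓ + 1 ≤ 2 ^ (m + 1) := by
    have : ℓ + 1 ≤ 2 ^ ℓ := Nat.lt_two_pow_self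
    calc ℓ + 1 ≤ 2 ^ ℓ := this
      _ ≤ 2 * m := h1
      _ ≤ 2 ^ (m + 1) := by rw [pow_succ]; omega
  have h5 : s * s + 1 ≤ (s + 2) ^ 2 := by nlinarith
  calc 2 * (s * s + 1) * ((ℓ + 1) * (2 * m) ^ (2 * ℓ))
      ≤ 2 * (s + 2) ^ 2 * (2 ^ (m + 1) * 2 ^ (10 * m)) := by
        gcongr
    _ = 2 ^ (11 * m + 2) * (s + 2) ^ 2 := by ring
    _ ≤ 2 ^ (13 * m) * (s + 2) ^ 2 := by
        refine Nat.mul_le_mul_right _ (Nat.pow_le_pow_right (by norm_num) (by omega))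

/-- **THE LIFTED PENCIL COUNT (memo `memo-logSumEngine-core.md`, verbatim statement, `a = 13`, `b = 2`).**  There are
absolute constants `a, b` such that for all `m, s`, all pairs of `m`-point configurations `A, B ⊂ ℂ^s`, all strictly
positive gradings `θ₁, θ₂`, every finite set of multi-indices that are pencil-visible unequal moments (unequal moment
`Σ_j A_j^μ ≠ Σ_j B_j^μ`, strict `(θ₁ + cθ₂)`-minimiser of the unequal moments for some `c > 0`) has at most
`2^{a m}(s+2)^b` elements.  Proof: `liftedPencilCount_bound` + `liftedPencilCount_arith` (and `m = 0`: no unequal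
moments).  This is the statement proved NECESSARY for `LogSumEngine` / `TwoProducts` in
`…LiftedNecessityReal.liftedPencilCount_of_twoProducts`; here it is proved OUTRIGHT (positivity of `θ` is not even
used). [folklore] -/
theorem liftedPencilCount :
    ∃ a b : ℕ, ∀ (m s : ℕ) (A B : Fin m → Fin s → ℂ) (θ₁ θ₂ : Fin s → ℝ),
      (∀ i, 0 < θ₁ i) → (∀ i, 0 < θ₂ i) →
      ∀ S : Finset (Fin s → ℕ),
        (∀ μ ∈ S, (∑ j, ∏ i, A j i ^ μ i) ≠ (∑ j, ∏ i, B j i ^ μ i) ∧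
          ∃ c : ℝ, 0 < c ∧ ∀ ν : Fin s → ℕ, ν ≠ μ →
            (∑ j, ∏ i, A j i ^ ν i) ≠ (∑ j, ∏ i, B j i ^ ν i) →
              ∑ i, (θ₁ i + c * θ₂ i) * (μ i : ℝ) < ∑ i, (θ₁ i + c * θ₂ i) * (ν i : ℝ)) →
        S.card ≤ 2 ^ (a * m) * (s + 2) ^ b := by
  refine ⟨13, 2, fun m s A B θ₁ θ₂ _ _ S hS => ?_⟩
  rcases Nat.eq_zero_or_pos m with hm0 | hmpos
  · -- no points: no unequal moments
    subst hm0
    have : S = ∅ := Finset.eq_empty_of_forall_notMem fun μ hμ => (hS μ hμ).1 (by simp)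
    simp [this]
  exact (liftedPencilCount_bound A B θ₁ θ₂ S hS).trans (liftedPencilCount_arith m s hmpos)

end Summit.ValiantsHypothesis.ValiantsHypothesis.Theorems.NewtonUnitEquations.TwoProducts.FormalLogLinearisation

end
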